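import Literature.AlgebraicGeometry.Resolution.AdicQuotient
import Mathlib.RingTheory.LocalRing.RingHom.Basic
import Mathlib.RingTheory.Ideal.Quotient.Operations
import HarnessLib

/-!
# [OURS · L1 W4.2 · D14 ROUTE H · H∞-b] Completion of a hypersurface quotient, read through a formal frame

Sub-problem `ResolutionOfSingularities`, crux `SigmaMaxModifications` / conjunct `SigmaMaxModificationsCorridor3`
(route `HilbertSamuelElimination`, line `w_ladder`), idea chain L1 C5 «K1 FREE-RATIONAL TAILS», ROUTE H (hypersurface cell).

The base formal frame (`…IsoTailsFormalFrameBase`) is `ψ₀ = Ψ⁻¹ ∘ (R → R̂) : R →+* S` with `Ψ : S ≃+* R̂` (`S = κ⟦X_0,…,X_3⟧`,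
`R̂ = AdicCompletion 𝔪 R`) and the recorded clause `Ψ (ψ₀ r) = algebraMap R R̂ r`.  The final assembly of K1's hypersurface cell
compares the local ring of the singularity, presented as `R ⧸ (h)`, with the formal hypersurface `S ⧸ (ψ₀ h)` on which the arc
contradiction (`…IsoTailsArcContradiction`) lives; the comparison is the isomorphism of this file:

* `exists_quotientFrameEquiv` — **`(R ⧸ (h))^ ≃+* S ⧸ (ψ₀ h)`**, natural on `R` (`r mod h ↦ ψ₀ r mod ψ₀ h`): the composite of
  `𝔪_{R/(h)} = 𝔪 · (R/(h))` (transport of the adic topology), «completion commutes with quotients»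
  `R̂ ⧸ h R̂ ≃ (R ⧸ (h))^` (tree `Literature.AlgebraicGeometry.Resolution.quotientCompletionEquiv`, Matsumura Thm. 8.11), and the quotient
  of `Ψ⁻¹ : R̂ ≃ S`, which maps `h R̂` onto `(ψ₀ h)`;
* `map_span_singleton_symm_eq` — the bookkeeping `Ψ⁻¹ (h R̂) = (ψ₀ h)`.

It is consumed together with `IdeasL1C4.isIsolatedInHSMaxLocus_adicCompletion_of_ringEquiv` (`…Corridor3WLadderIsolatedCompletion`),
which transports isolation in the Hilbert–Samuel maximal locus from `Spec A` to `Spec S'` along any `Â ≃+* S'`.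
Everything here is OURS (elementary commutative algebra on Mathlib's `AdicCompletion`); no statement of the manuscript under adjudication
and no unproved published theorem is asserted. Reference for the folklore: H. Matsumura, *Commutative Ring Theory* (1986), Thm. 8.11 p. 61
[Matsumura1987].
-/

set_option linter.dupNamespace false -- mandated namespace of this single-conjunct summit
open IsLocalRing
open Literature.AlgebraicGeometry.Resolution

namespace Summit.ResolutionOfSingularities.ResolutionOfSingularities.Cruxes.SigmaMaxModifications.IdeasL1C5

namespace FormalFrame

universe u v

variable {R : Type u} [CommRing R] [IsLocalRing R] [IsNoetherianRing R]
variable {S : Type v} [CommRing S]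

omit [IsNoetherianRing R] in
/-- [OURS · L1 W4.2] Bookkeeping: along `Ψ⁻¹ : R̂ ≃ S`, the extended ideal `h R̂` goes to `(ψ₀ h)` when `Ψ (ψ₀ h) = h`. [folklore] -/
theorem map_span_singleton_symm_eq (Ψ : S ≃+* AdicCompletion (maximalIdeal R) R) (ψ₀ : R →+* S)
    (hΨψ₀ : ∀ r, Ψ (ψ₀ r) = algebraMap R (AdicCompletion (maximalIdeal R) R) r) (h : R) :
    ((Ideal.span {h}).map (algebraMap R (AdicCompletion (maximalIdeal R) R))).map
        (Ψ.symm : AdicCompletion (maximalIdeal R) R →+* S) = Ideal.span {ψ₀ h} := by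
  rw [Ideal.map_span, Set.image_singleton, Ideal.map_span, Set.image_singleton, RingHom.coe_coe, ← hΨψ₀,
    RingEquiv.symm_apply_apply]

/-- [OURS · L1 W4.2] **`(R ⧸ (h))^ ≃ S ⧸ (ψ₀ h)` through a formal frame.** For a Noetherian local ring `R`, a ring isomorphism
`Ψ : S ≃+* R̂` onto its adic completion and `ψ₀ : R →+* S` with `Ψ (ψ₀ r) = algebraMap R R̂ r`, and any `h : R` with `R ⧸ (h)`
local (e.g. `h ∈ 𝔪_R`): the adic completion of `R ⧸ (h)` is isomorphic to `S ⧸ (ψ₀ h)`, naturally in `R`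
(`r mod h ↦ ψ₀ r mod ψ₀ h`). [cite: Matsumura1987, Thm. 8.11] -/
theorem exists_quotientFrameEquiv (Ψ : S ≃+* AdicCompletion (maximalIdeal R) R) (ψ₀ : R →+* S)
    (hΨψ₀ : ∀ r, Ψ (ψ₀ r) = algebraMap R (AdicCompletion (maximalIdeal R) R) r) (h : R)
    [IsLocalRing (R ⧸ Ideal.span {h})] :
    ∃ e : AdicCompletion (maximalIdeal (R ⧸ Ideal.span {h})) (R ⧸ Ideal.span {h}) ≃+* S ⧸ Ideal.span {ψ₀ h},
      ∀ r : R, e (algebraMap (R ⧸ Ideal.span {h}) _ (Ideal.Quotient.mk (Ideal.span {h}) r)) =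
        Ideal.Quotient.mk (Ideal.span {ψ₀ h}) (ψ₀ r) := by
  set J : Ideal R := Ideal.span {h} with hJ
  -- (1) transport of the adic topology: `𝔪_{R/J} = 𝔪 · (R/J)`
  have he : (maximalIdeal (R ⧸ J)).map (RingEquiv.refl (R ⧸ J)).toRingHom =
      (maximalIdeal R).map (Ideal.Quotient.mk J) := by
    rw [← map_maximalIdeal_of_surjective (Ideal.Quotient.mk J) Ideal.Quotient.mk_surjective, Ideal.map_map]
    rfl
  let e₁ := adicCompletionCongr (maximalIdeal (R ⧸ J)) ((maximalIdeal R).map (Ideal.Quotient.mk J))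
    (RingEquiv.refl (R ⧸ J)) he
  -- (2) completion commutes with quotients
  let e₂ := (quotientCompletionEquiv (maximalIdeal R) J).symm
  -- (3) the quotient of `Ψ⁻¹`
  let e₃ := Ideal.quotientEquiv (J.map (algebraMap R (AdicCompletion (maximalIdeal R) R))) (Ideal.span {ψ₀ h}) Ψ.symm
    (map_span_singleton_symm_eq Ψ ψ₀ hΨψ₀ h).symm
  refine ⟨(e₁.trans e₂).trans e₃, fun r => ?_⟩
  rw [RingEquiv.trans_apply, RingEquiv.trans_apply]
  have h1 : e₁ (algebraMap (R ⧸ J) _ (Ideal.Quotient.mk J r)) =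
      AdicCompletion.of ((maximalIdeal R).map (Ideal.Quotient.mk J)) (R ⧸ J) (Ideal.Quotient.mk J r) := by
    rw [AdicCompletion.algebraMap_apply, Algebra.algebraMap_self, RingHom.id_apply]
    exact adicCompletionCongr_of _ _ _ he _
  have h2 : e₂ (AdicCompletion.of ((maximalIdeal R).map (Ideal.Quotient.mk J)) (R ⧸ J) (Ideal.Quotient.mk J r)) =
      Ideal.Quotient.mk _ (AdicCompletion.of (maximalIdeal R) R r) := by
    rw [RingEquiv.symm_apply_eq]
    exact (quotientCompletionEquiv_mk_of (maximalIdeal R) J r).symm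
  rw [h1, h2]
  change Ideal.quotientEquiv _ _ Ψ.symm _ (Ideal.Quotient.mk _ _) = _
  rw [Ideal.quotientEquiv_mk]
  congr 1
  rw [← RingEquiv.symm_apply_apply Ψ (ψ₀ r), hΨψ₀, AdicCompletion.algebraMap_apply, Algebra.algebraMap_self,
    RingHom.id_apply]

/-- [OURS · L1 W4.2] **`Â ≃ S ⧸ (ψ₀ h)` for a presented hypersurface local ring.** Same as `exists_quotientFrameEquiv`, with
`R ⧸ (h)` replaced by any local ring `A` presented as `σ : R ↠ A`, `ker σ = (h)` (e.g. the local ring of the singularity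
`𝒪_{X,x}` with its hypersurface presentation); natural in `R`: `σ r ↦ ψ₀ r mod ψ₀ h`. This is the ring isomorphism fed to
`IdeasL1C4.isIsolatedInHSMaxLocus_adicCompletion_of_ringEquiv`. [cite: Matsumura1987, Thm. 8.11] -/
theorem exists_completionEquiv_of_presentation (Ψ : S ≃+* AdicCompletion (maximalIdeal R) R) (ψ₀ : R →+* S)
    (hΨψ₀ : ∀ r, Ψ (ψ₀ r) = algebraMap R (AdicCompletion (maximalIdeal R) R) r) (h : R)
    {A : Type u} [CommRing A] [IsLocalRing A] (σ : R →+* A) (hσ : Function.Surjective σ)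
    (hker : RingHom.ker σ = Ideal.span {h}) :
    ∃ e : AdicCompletion (maximalIdeal A) A ≃+* S ⧸ Ideal.span {ψ₀ h},
      ∀ r : R, e (algebraMap A _ (σ r)) = Ideal.Quotient.mk (Ideal.span {ψ₀ h}) (ψ₀ r) := by
  -- `R ⧸ (h) ≃ A`
  let eA : (R ⧸ Ideal.span {h}) ≃+* A :=
    (Ideal.quotEquivOfEq hker.symm).trans (RingHom.quotientKerEquivOfSurjective hσ)
  have heA : ∀ r, eA (Ideal.Quotient.mk _ r) = σ r := fun r => by
    simp only [eA, RingEquiv.trans_apply, Ideal.quotEquivOfEq_mk, RingHom.quotientKerEquivOfSurjective_apply_mk]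
  haveI : IsLocalRing (R ⧸ Ideal.span {h}) := eA.symm.isLocalRing
  -- transport of the completion along `eA⁻¹`
  have he : (maximalIdeal A).map eA.symm.toRingHom = maximalIdeal (R ⧸ Ideal.span {h}) :=
    map_ringEquiv_maximalIdeal eA.symm
  let e₀ := adicCompletionCongr (maximalIdeal A) (maximalIdeal (R ⧸ Ideal.span {h})) eA.symm he
  obtain ⟨e, hq⟩ := exists_quotientFrameEquiv Ψ ψ₀ hΨψ₀ h
  refine ⟨e₀.trans e, fun r => ?_⟩
  rw [RingEquiv.trans_apply]
  have h0 : e₀ (algebraMap A _ (σ r)) = algebraMap (R ⧸ Ideal.span {h}) _ (Ideal.Quotient.mk (Ideal.span {h}) r) := by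
    rw [AdicCompletion.algebraMap_apply, Algebra.algebraMap_self, RingHom.id_apply, AdicCompletion.algebraMap_apply,
      Algebra.algebraMap_self, RingHom.id_apply]
    refine (adicCompletionCongr_of _ _ _ he _).trans ?_
    congr 1
    rw [RingEquiv.symm_apply_eq, heA]
  rw [h0, hq]

end FormalFrame

end Summit.ResolutionOfSingularities.ResolutionOfSingularities.Cruxes.SigmaMaxModifications.IdeasL1C5
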